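import Literature.NumberTheory.GaloisRepresentations.GaloisRep
import Mathlib.RingTheory.LocalRing.ResidueField.Basic
import Mathlib.RingTheory.Localization.FractionRing
import Mathlib.RepresentationTheory.Invariants
import Mathlib.Algebra.CharP.Defs
import HarnessLib

/-!
# Minimally ramified two-dimensional Galois representations (Diamond–Flach–Guo)

Let `A` be a commutative local ring with residue field `κ = A/𝔪` of characteristic `ℓ`
(`ℓ = ringChar κ`; intended: `A` the ring of integers of a finite extension of `ℚ_ℓ`, or the
valuation ring `ℤ̄_ℓ` of `ℚ̄_ℓ`) and fraction ring `Frac A`, and let `ρ : Γ_K →ₜ* GL₂(A)` be a framed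
two-dimensional representation of the absolute Galois group of a field `K` (tree:
`FramedGaloisRep K A 2`).  Write `ρ̄ = ρ mod 𝔪 : Γ_K → GL₂(κ)` for its reduction
(`FramedRep.reduction`) and, for a prime `𝔓` of `\bar ℤ_K = absIntegers (𝓞 K) K`,
`I_𝔓 ≤ Γ_K` for its inertia group (Mathlib `Ideal.inertia`, as in
`FramedGaloisRep.IsUnramifiedAt`).

Diamond–Flach–Guo, *The Tamagawa number conjecture of adjoint motives of modular forms*,
§3.1 (p. 715), define (their `p` is a prime different from the residue characteristic `ℓ`,
`ρ₀` the residual representation, `V_ρ ≅ K_ρ²` the representation space of `ρ`):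

> "For a prime `p ≠ ℓ`, we say `ρ` is *minimally ramified* at `p` if the following hold:
> • If `#ρ₀(I_p) ≠ ℓ`, then `ρ(I_p) ≅ ρ₀(I_p)`.
> • If `#ρ₀(I_p) = ℓ`, then `dim_{K_ρ} V_ρ^{I_p} = 1`."

and, for a set of primes `Σ` not containing `ℓ`, "`Σ_ρ` = the set of primes at which `ρ` is not
minimally ramified", "minimally ramified outside `Σ`" meaning `Σ_ρ ⊆ Σ` (op. cit. pp. 715–717).
This file vendors exactly this predicate:

* `FramedRep.reduction ρ : Γ →* GL_n(κ)` — reduction of a framed representation over a local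
  ring modulo the maximal ideal (`Matrix.GeneralLinearGroup.map (IsLocalRing.residue A)`, the
  idiom of `ResidualRepresentation.lean` / `AbsolutelyIrreducibleReduction.lean`, here given a
  name); `reduction_apply_eq_one_iff` (`ρ̄ σ = 1 ↔ ρ σ ≡ 1 mod 𝔪` entrywise).
* `FramedGaloisRep.inertiaInvariants 𝔓 ρ ⊆ (Frac A)ⁿ` — the subspace `V^{I_𝔓}` of
  `I_𝔓`-invariants of `V = (Frac A)ⁿ` with `Γ_K` acting through `ρ ⊗_A Frac A`
  (Mathlib `Representation.invariants` of `FramedRep.baseChangeRepresentation`).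
* `FramedGaloisRep.IsMinimallyRamifiedAtPrime 𝔓 ρ` (rank `2`): the conjunction of the two
  displayed clauses, with `#ρ₀(I_p)` rendered as `Nat.card` of the subgroup `ρ̄(I_𝔓) ≤ GL₂(κ)`,
  `ℓ` as `ringChar κ`, "`ρ(I_p) ≅ ρ₀(I_p)`" as *the reduction map `ρ(I_𝔓) ↠ ρ̄(I_𝔓)` is
  injective*, i.e. `σ ∈ I_𝔓, ρ̄ σ = 1 ⇒ ρ σ = 1` (for finite `ρ̄(I_𝔓)` — always the case when `κ`
  is finite — an abstract isomorphism `ρ(I_𝔓) ≅ ρ̄(I_𝔓)` forces `ρ(I_𝔓)` to be finite of the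
  same order, so the canonical surjection is bijective; conversely), and
  "`dim_{K_ρ} V_ρ^{I_p} = 1`" as `Module.finrank (Frac A) (inertiaInvariants 𝔓 ρ) = 1`.
* `FramedGaloisRep.IsMinimallyRamifiedAt v ρ` — at a finite place `v` of `K`: at every prime
  `𝔓 ∣ v` of `\bar ℤ_K` (conjugation-invariant, so no prime is chosen; the convention of
  `FramedGaloisRep.IsUnramifiedAt`), and `IsMinimallyRamifiedOutside S ρ`.
* API: `IsUnramifiedAt.isMinimallyRamifiedAt` (an unramified representation is minimally
  ramified: `ρ(I_𝔓) = 1` gives `#ρ̄(I_𝔓) = 1 ≠ ℓ` and the first clause holds trivially);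
  conversely `IsMinimallyRamifiedAt.isUnramifiedAt_of_reduction_eq_one` (minimally ramified
  and RESIDUALLY unramified implies unramified — Darmon–Diamond–Taylor's type-`Σ` clause,
  §2.7 p. 76); unfolding lemmas, `IsMinimallyRamifiedOutside.mono`.

## Design notes

* DFG fix the residual representation `ρ₀ : G_ℚ → Aut_κ(V₀)` first and consider `ρ` with
  "reduction isomorphic to `ρ₀` over `κ̄`"; for a single framed `ρ` the role of `ρ₀` is played
  by its own reduction `ρ̄` (for residually absolutely irreducible `ρ` all reductions of all
  lattices are isomorphic over `κ̄`, so `#ρ̄(I_𝔓) = #ρ₀(I_𝔓)` and nothing is lost; for residually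
  reducible `ρ` the order `#ρ̄(I_𝔓)` may depend on the lattice, exactly as in the source, where
  minimal ramification is only used for absolutely irreducible `ρ₀`).  DFG's standing
  hypotheses of §3.1 (`ρ₀` odd, irreducible, of minimal conductor among its twists, Serre weight
  `2 ≤ k ≤ ℓ - 1`) are hypotheses of their theorems, not of this definition, and are not
  imposed here; under them `ℓ ∣ #ρ₀(I_p)` forces `#ρ₀(I_p) = ℓ` (`ρ₀|_{I_p} ≅ χ ⊗ (1 *; 0 1)`
  with `χ` unramified at `p` by twist-minimality), which is why the dichotomy is phrased
  through `#ρ₀(I_p) = ℓ`.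
* The predicate is stated over any field `K` (intended: `K = ℚ`, the setting of the source) and
  any commutative local ring `A` (intended: a discrete valuation ring finite over `ℤ_ℓ`, or
  `ℤ̄_ℓ`); `Frac A = FractionRing A` (Mathlib) is a field when `A` is a domain.  Rank `2` only:
  the second clause is specific to `GL₂`.
* Global inertia groups `I_𝔓 ≤ Γ_K` (Mathlib `Ideal.inertia`, all `𝔓 ∣ v`) rather than the
  local `absInertia (K_v)`: the convention of `FramedGaloisRep.IsUnramifiedAt` and of
  `IsGaloisRepOfNewform1Int`, with which this predicate is combined in
  `Literature.NumberTheory.Automorphic.HeckeAlgebraOfTypeSigma` (the Hecke algebra `T_Σ`).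
* Mathlib has `Ideal.inertia`, `IsLocalRing.residue`, `Matrix.GeneralLinearGroup.map`,
  `Representation.invariants`, `Module.finrank`, but no reduction of representations and no
  ramification conditions on Galois representations (`lean search` "MinimallyRamified",
  "minimally": no hits in Mathlib or the tree).

## References

* F. Diamond, M. Flach, L. Guo, *The Tamagawa number conjecture of adjoint motives of modular
  forms*, Ann. Sci. ÉNS (4) 37 (2004), 663–727: §3.1, p. 715 (definition of minimally ramified
  and of `Σ_ρ`), p. 717 (`A`-deformations minimally ramified at `p`, deformations of type `Σ`).
  [DiamondFlachGuo2004]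
* H. Darmon, F. Diamond, R. Taylor, *Fermat's Last Theorem*, CDM 1995, §2.7 (p. 76: liftings of
  type `Σ`, the semistable special case "if `p ∉ Σ ∪ {ℓ}` and `ρ̄` is unramified at `p` then `ρ`
  is unramified at `p`; `ρ|_{I_p} ∼ (1 *; 0 1)`"). [DarmonDiamondTaylor1995]
-/

noncomputable section

open scoped NumberField MatrixGroups
open Field IsDedekindDomain IsLocalRing

namespace Literature.NumberTheory.GaloisRepresentations

universe u v

/-! ### Reduction of a framed representation modulo the maximal ideal -/

namespace FramedRep

variable {Γ : Type u} [Group Γ] [TopologicalSpace Γ] {A : Type v} [CommRing A] [IsLocalRing A]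
  [TopologicalSpace A] {n : ℕ}

/-- The **reduction** `ρ̄ = ρ mod 𝔪 : Γ → GL_n(κ)` of a framed representation
`ρ : Γ →ₜ* GL_n(A)` over a commutative local ring `A` with residue field `κ = A/𝔪`
(Mathlib `IsLocalRing.residue`, `Matrix.GeneralLinearGroup.map`), as a bare group homomorphism.
(Darmon–Diamond–Taylor §2.1, p. 54: "Reducing modulo the maximal ideal gives a residual
representation `ρ̄ : G_ℚ → GL_d(k)`"; DFG §3.1: `ρ₀`.) [folklore] -/
def reduction (ρ : FramedRep Γ A n) : Γ →* GL (Fin n) (ResidueField A) :=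
  (Matrix.GeneralLinearGroup.map (residue A)).comp (ρ : Γ →* GL (Fin n) A)

/-- Unfolding lemma for `FramedRep.reduction`. [folklore] -/
@[simp] theorem reduction_apply (ρ : FramedRep Γ A n) (σ : Γ) :
    ρ.reduction σ = Matrix.GeneralLinearGroup.map (residue A) (ρ σ) :=
  rfl

/-- Entries of the reduction are the residues of the entries. [folklore] -/
theorem coe_reduction_apply (ρ : FramedRep Γ A n) (σ : Γ) (i j : Fin n) :
    ((ρ.reduction σ : GL (Fin n) (ResidueField A)) : Matrix (Fin n) (Fin n) (ResidueField A)) i j =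
      residue A (((ρ σ : GL (Fin n) A) : Matrix (Fin n) (Fin n) A) i j) :=
  rfl

/-- `ρ̄ σ = 1` iff `ρ σ ≡ 1 (mod 𝔪)` entrywise. [folklore] -/
theorem reduction_apply_eq_one_iff (ρ : FramedRep Γ A n) (σ : Γ) :
    ρ.reduction σ = 1 ↔ ∀ i j : Fin n,
      ((ρ σ : GL (Fin n) A) : Matrix (Fin n) (Fin n) A) i j - (1 : Matrix (Fin n) (Fin n) A) i j ∈
        maximalIdeal A := by
  rw [← Units.val_inj, Units.val_one, ← Matrix.ext_iff]
  refine forall₂_congr fun i j => ?_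
  rw [coe_reduction_apply, ← Ideal.Quotient.mk_eq_mk_iff_sub_mem]
  change _ ↔ residue A _ = residue A _
  have h1 : residue A ((1 : Matrix (Fin n) (Fin n) A) i j) =
      (1 : Matrix (Fin n) (Fin n) (ResidueField A)) i j := by
    rw [Matrix.one_apply, Matrix.one_apply, apply_ite (residue A), map_one, map_zero]
  rw [h1]

end FramedRep

/-! ### Minimal ramification (Diamond–Flach–Guo §3.1) -/

namespace FramedGaloisRep

variable {K : Type u} [Field K] {A : Type v} [CommRing A] [TopologicalSpace A] {n : ℕ}

/-- The subspace `V^{I_𝔓} ⊆ V = (Frac A)ⁿ` of vectors fixed by the inertia group `I_𝔓 ≤ Γ_K` of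
the prime `𝔓` of `\bar ℤ_K` acting through `ρ ⊗_A Frac A` (`σ ↦ (ρ σ).map (A → Frac A)`;
Mathlib `Representation.invariants` of `FramedRep.baseChangeRepresentation` restricted to
`I_𝔓 = 𝔓.inertia Γ_K`).  Its dimension is DFG's `dim_{K_ρ} V_ρ^{I_p}`.
[cite: DiamondFlachGuo2004, §3.1, p. 715] -/
def inertiaInvariants (𝔓 : Ideal (absIntegers (𝓞 K) K)) (ρ : FramedGaloisRep K A n) :
    Submodule (FractionRing A) (Fin n → FractionRing A) :=
  Representation.invariants
    ((FramedRep.baseChangeRepresentation (algebraMap A (FractionRing A)) ρ).comp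
      (𝔓.inertia (absoluteGaloisGroup K)).subtype)

/-- Membership in `V^{I_𝔓}`: `x` is fixed by `ρ(σ) ⊗ 1` for every `σ ∈ I_𝔓`. [folklore] -/
theorem mem_inertiaInvariants_iff {𝔓 : Ideal (absIntegers (𝓞 K) K)} {ρ : FramedGaloisRep K A n}
    {x : Fin n → FractionRing A} :
    x ∈ ρ.inertiaInvariants 𝔓 ↔ ∀ σ ∈ 𝔓.inertia (absoluteGaloisGroup K),
      ((Matrix.GeneralLinearGroup.map (algebraMap A (FractionRing A)) (ρ σ) :
          GL (Fin n) (FractionRing A)) : Matrix (Fin n) (Fin n) (FractionRing A)).mulVec x = x := by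
  rw [inertiaInvariants, Representation.mem_invariants, Subtype.forall]
  rfl

variable [IsLocalRing A]

/-- **Minimally ramified at the prime `𝔓` of `\bar ℤ_K`** (Diamond–Flach–Guo §3.1, p. 715), for
a framed two-dimensional representation `ρ : Γ_K →ₜ* GL₂(A)` over a local ring `A` with residue
field `κ` of characteristic `ℓ = ringChar κ`, reduction `ρ̄ = FramedRep.reduction ρ` and inertia
group `I_𝔓 = 𝔓.inertia Γ_K`:
* if `#ρ̄(I_𝔓) ≠ ℓ` then `ρ(I_𝔓) ≅ ρ̄(I_𝔓)`, i.e. the reduction map is injective on `ρ(I_𝔓)`: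
  `σ ∈ I_𝔓`, `ρ̄ σ = 1 ⟹ ρ σ = 1`;
* if `#ρ̄(I_𝔓) = ℓ` then `dim_{Frac A} V^{I_𝔓} = 1` (`inertiaInvariants`).
Verbatim the source's two clauses ("If `#ρ₀(I_p) ≠ ℓ`, then `ρ(I_p) ≅ ρ₀(I_p)`.  If
`#ρ₀(I_p) = ℓ`, then `dim_{K_ρ} V_ρ^{I_p} = 1`."), with `ρ₀ := ρ̄` and `#` = `Nat.card` (so an
infinite `ρ̄(I_𝔓)` counts as `0 ≠ ℓ`).  Intended for `𝔓 ∤ ℓ` and residually absolutely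
irreducible `ρ` (see the module docstring for the scope of the source).
[cite: DiamondFlachGuo2004, §3.1, p. 715] -/
def IsMinimallyRamifiedAtPrime (𝔓 : Ideal (absIntegers (𝓞 K) K)) (ρ : FramedGaloisRep K A 2) :
    Prop :=
  (Nat.card ((𝔓.inertia (absoluteGaloisGroup K)).map (FramedRep.reduction ρ)) ≠
        ringChar (ResidueField A) →
      ∀ σ ∈ 𝔓.inertia (absoluteGaloisGroup K), FramedRep.reduction ρ σ = 1 → ρ σ = 1) ∧
    (Nat.card ((𝔓.inertia (absoluteGaloisGroup K)).map (FramedRep.reduction ρ)) =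
        ringChar (ResidueField A) →
      Module.finrank (FractionRing A) (ρ.inertiaInvariants 𝔓) = 1)

/-- Unfolding lemma for `IsMinimallyRamifiedAtPrime`. [folklore] -/
theorem isMinimallyRamifiedAtPrime_iff (𝔓 : Ideal (absIntegers (𝓞 K) K))
    (ρ : FramedGaloisRep K A 2) :
    ρ.IsMinimallyRamifiedAtPrime 𝔓 ↔
      (Nat.card ((𝔓.inertia (absoluteGaloisGroup K)).map (FramedRep.reduction ρ)) ≠
            ringChar (ResidueField A) →
          ∀ σ ∈ 𝔓.inertia (absoluteGaloisGroup K), FramedRep.reduction ρ σ = 1 → ρ σ = 1) ∧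
        (Nat.card ((𝔓.inertia (absoluteGaloisGroup K)).map (FramedRep.reduction ρ)) =
            ringChar (ResidueField A) →
          Module.finrank (FractionRing A) (ρ.inertiaInvariants 𝔓) = 1) :=
  Iff.rfl

/-- **Minimally ramified at the finite place `v` of `K`** (Diamond–Flach–Guo §3.1, p. 715:
"minimally ramified at `p`", `K = ℚ`): minimally ramified at every prime `𝔓` of `\bar ℤ_K` above
`v` (the clauses are invariant under conjugating `𝔓`, so equivalently at one `𝔓`; all `𝔓 ∣ v`
is the choice-free convention of `FramedGaloisRep.IsUnramifiedAt`).  Rational primes `r` are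
matched with places of `ℚ` by Mathlib's `Rat.HeightOneSpectrum.primesEquiv`.
[cite: DiamondFlachGuo2004, §3.1, p. 715] -/
def IsMinimallyRamifiedAt (v : HeightOneSpectrum (𝓞 K)) (ρ : FramedGaloisRep K A 2) : Prop :=
  ∀ 𝔓 ∈ v.primesAbove, ρ.IsMinimallyRamifiedAtPrime 𝔓

/-- Unfolding lemma for `IsMinimallyRamifiedAt`. [folklore] -/
theorem isMinimallyRamifiedAt_iff (v : HeightOneSpectrum (𝓞 K)) (ρ : FramedGaloisRep K A 2) :
    ρ.IsMinimallyRamifiedAt v ↔ ∀ 𝔓 ∈ v.primesAbove, ρ.IsMinimallyRamifiedAtPrime 𝔓 :=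
  Iff.rfl

/-- **Minimally ramified outside `S`**: minimally ramified at every finite place `v ∉ S`
(Diamond–Flach–Guo p. 715: `Σ_ρ ⊆ Σ`, "`Σ_ρ` the set of primes at which `ρ` is not minimally
ramified"; p. 717: "the `A G_ℚ`-module `M` is minimally ramified outside `Σ`").  In the source `Σ`
never contains the residue characteristic; callers add that place to `S`.
[cite: DiamondFlachGuo2004, §3.1, pp. 715–717] -/
def IsMinimallyRamifiedOutside (S : Set (HeightOneSpectrum (𝓞 K))) (ρ : FramedGaloisRep K A 2) :
    Prop :=
  ∀ v ∉ S, ρ.IsMinimallyRamifiedAt v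

/-- A representation with `ρ(I_𝔓) = 1` is minimally ramified at `𝔓`: then `ρ̄(I_𝔓) = 1` has
`Nat.card = 1 ≠ ringChar κ` (a field has characteristic `≠ 1`), so only the first clause
applies, and it holds trivially. (Implicit in DFG §3.1: `Σ_ρ` is contained in the set of
ramified primes.) [folklore] -/
theorem isMinimallyRamifiedAtPrime_of_forall_eq_one {𝔓 : Ideal (absIntegers (𝓞 K) K)}
    {ρ : FramedGaloisRep K A 2} (h : ∀ σ ∈ 𝔓.inertia (absoluteGaloisGroup K), ρ σ = 1) :
    ρ.IsMinimallyRamifiedAtPrime 𝔓 := by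
  have hbot : (𝔓.inertia (absoluteGaloisGroup K)).map (FramedRep.reduction ρ) = ⊥ := by
    rw [Subgroup.map_eq_bot_iff]
    intro σ hσ
    rw [MonoidHom.mem_ker, FramedRep.reduction_apply, h σ hσ, map_one]
  have hcard : Nat.card ((𝔓.inertia (absoluteGaloisGroup K)).map (FramedRep.reduction ρ)) = 1 := by
    rw [hbot]
    exact Subgroup.card_bot
  refine ⟨fun _ σ hσ _ => h σ hσ, fun hc => ?_⟩
  exact absurd (hcard.symm.trans hc).symm (CharP.ringChar_ne_one (R := ResidueField A))

/-- **Minimally ramified and residually unramified implies unramified** at `𝔓`: if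
`ρ̄(I_𝔓) = 1` then `#ρ̄(I_𝔓) = 1 ≠ ℓ`, so the first clause gives `ρ(I_𝔓) = 1`.  This is the
clause "if `p ∉ Σ ∪ {ℓ}` and `ρ̄` is unramified at `p` then `ρ` is unramified at `p`" of
Darmon–Diamond–Taylor's liftings of type `Σ` (§2.7, p. 76), recovered from DFG's definition.
[cite: DarmonDiamondTaylor1995, §2.7, p. 76] -/
theorem IsMinimallyRamifiedAtPrime.eq_one_of_reduction_eq_one {𝔓 : Ideal (absIntegers (𝓞 K) K)}
    {ρ : FramedGaloisRep K A 2} (h : ρ.IsMinimallyRamifiedAtPrime 𝔓)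
    (hres : ∀ σ ∈ 𝔓.inertia (absoluteGaloisGroup K), FramedRep.reduction ρ σ = 1)
    {σ : absoluteGaloisGroup K} (hσ : σ ∈ 𝔓.inertia (absoluteGaloisGroup K)) : ρ σ = 1 := by
  have hbot : (𝔓.inertia (absoluteGaloisGroup K)).map (FramedRep.reduction ρ) = ⊥ := by
    rw [Subgroup.map_eq_bot_iff]
    intro τ hτ
    rw [MonoidHom.mem_ker, hres τ hτ]
  have hcard : Nat.card ((𝔓.inertia (absoluteGaloisGroup K)).map (FramedRep.reduction ρ)) = 1 := by
    rw [hbot]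
    exact Subgroup.card_bot
  have hne : Nat.card ((𝔓.inertia (absoluteGaloisGroup K)).map (FramedRep.reduction ρ)) ≠
      ringChar (ResidueField A) := by
    rw [hcard]
    exact (CharP.ringChar_ne_one (R := ResidueField A)).symm
  exact h.1 hne σ hσ (hres σ hσ)

/-- **Minimally ramified and residually unramified at `v` implies unramified at `v`**
(DDT §2.7, p. 76, as above, at every `𝔓 ∣ v`). [cite: DarmonDiamondTaylor1995, §2.7, p. 76] -/
theorem IsMinimallyRamifiedAt.isUnramifiedAt_of_reduction_eq_one {v : HeightOneSpectrum (𝓞 K)}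
    {ρ : FramedGaloisRep K A 2} (h : ρ.IsMinimallyRamifiedAt v)
    (hres : ∀ 𝔓 ∈ v.primesAbove, ∀ σ ∈ 𝔓.inertia (absoluteGaloisGroup K),
      FramedRep.reduction ρ σ = 1) :
    ρ.IsUnramifiedAt v :=
  fun 𝔓 h𝔓 _ hσ => (h 𝔓 h𝔓).eq_one_of_reduction_eq_one (hres 𝔓 h𝔓) hσ

/-- **Unramified implies minimally ramified** (the lemma requested with the definition; DFG
§3.1: `Σ_ρ ⊆` ramified primes). [folklore] -/
theorem IsUnramifiedAt.isMinimallyRamifiedAt {v : HeightOneSpectrum (𝓞 K)}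
    {ρ : FramedGaloisRep K A 2} (h : ρ.IsUnramifiedAt v) : ρ.IsMinimallyRamifiedAt v :=
  fun 𝔓 h𝔓 => isMinimallyRamifiedAtPrime_of_forall_eq_one (h 𝔓 h𝔓)

/-- `IsMinimallyRamifiedOutside` is monotone in the exceptional set. [folklore] -/
theorem IsMinimallyRamifiedOutside.mono {S T : Set (HeightOneSpectrum (𝓞 K))}
    {ρ : FramedGaloisRep K A 2} (h : ρ.IsMinimallyRamifiedOutside S) (hST : S ⊆ T) :
    ρ.IsMinimallyRamifiedOutside T :=
  fun v hv => h v fun hS => hv (hST hS)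

/-- A representation unramified at every `v ∉ S` is minimally ramified outside `S`. [folklore] -/
theorem isMinimallyRamifiedOutside_of_forall_isUnramifiedAt {S : Set (HeightOneSpectrum (𝓞 K))}
    {ρ : FramedGaloisRep K A 2} (h : ∀ v ∉ S, ρ.IsUnramifiedAt v) :
    ρ.IsMinimallyRamifiedOutside S :=
  fun v hv => (h v hv).isMinimallyRamifiedAt

end FramedGaloisRep

end Literature.NumberTheory.GaloisRepresentations
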